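import Literature.Barriers.ResolutionOfSingularities.LocalFactorizationFailsDimThree
import Literature.AlgebraicGeometry.Resolution.QuadraticTransformsFactorization
import Mathlib.Algebra.Field.ULift
import HarnessLib

/-!
# Accessible over-rings in dimension `n` (Sally 1972): the Zariski–Abhyankar theorem holds for
`n = 2` and FAILS for `n = 3` — the dimension-indexed form of census row O2b

Sally [Sally1972, Def. 4.1]: "Let `(R, M)` be an `n`-dimensional regular local ring, `n > 1`. `T`
is a *simple extension* of `R` if `T` is the localization at a rank `n` prime of a ring generated
over `R` by a quotient of two elements of `R` which form a subset of a minimal basis for `M`. An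
`n`-dimensional regular local overring `T` of `R` is *accessible* from `R` if `T` can be obtained
from `R` by a finite sequence of simple extensions. In this terminology, the factorization theorem
of Zariski and Abhyankar [1] states that if `R` is a 2-dimensional regular local ring then every
2-dimensional regular local overring of `R` is accessible from `R`. For dimension `n > 2`, the
following theorem shows that every `n`-dimensional regular local ring `R` has infinitely many
regular local overrings which are not accessible from `R`."

This file states Sally's notions VERBATIM for subrings of a field `K` (`IsStrictSimpleExtension`,
strict = "the localization of `R[p/q]` at a prime of rank `n`", as opposed to the weaker
container notion `Sally1972.IsSimpleExtension` used in the barrier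
`LocalFactorizationFailsDimThree`), packages "every `n`-dimensional regular local over-ring of
an `n`-dimensional regular local ring `R` of `K` dominating `R` is accessible from `R`" as the
dimension-indexed statement `AccessibleInDim n`, and proves both sides of the census row:

* `accessibleInDim_two : AccessibleInDim 2` — Zariski–Abhyankar in Sally's language, from the
  tree's `AbhyankarQuadraticFactorization` machinery (`exists_quadraticTransform_dominated`,
  `exists_mem_or_inv_mem_of_sequence`): each quadratic transform `R → R₁` of a two-dimensional
  regular local ring with `dim R₁ = 2` is a strict simple extension `R₁ = R[y/x]_𝔭`, `𝔪_R = (x, y)`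
  (`isStrictSimpleExtension_of_isQuadraticTransform`);
* `not_accessibleInDim_three : ¬ AccessibleInDim 3` — Sally's Thm. 4.4 / Ex. 4.6 = Shannon's
  example, from the barrier `Sally1972_holds` (`Sally1972.div_not_mem_T`): over `k = ℚ` (lifted
  to the universe), `R = k[x,y,z]_{(x,y,z)} ⊂ T = k[t,y,z]_{(t,y,z)}`, `x = t(y² + z³)`, inside
  `K = k(t,y,z)`.

So row O2b of the dimension-four census is the one row whose statement one dimension DOWN is a
theorem of the tree and whose statement itself is REFUTED in the tree. The BARRIER (D-0021) block
— technique class, what it blocks, known evasions (Cutkosky's factorization along a valuation in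
characteristic zero), scope caveats — is on `Sally1972_holds` in `LocalFactorizationFailsDimThree`
and is not repeated here; this file adds no named fact (both instances of the predicate that the
census uses are decided below).

## References
* [Sally1972] J. D. Sally, Regular overrings of regular local rings, Trans. AMS 171 (1972)
  291–300, Def. 4.1, Thm. 4.4, Cor. 4.5, Ex. 4.6.
* [Shannon1973] D. L. Shannon, Monoidal transforms of regular local rings, Amer. J. Math. 95
  (1973) 294–320.
* [Abhyankar1956Valuations] S. Abhyankar, On the valuations centered in a local domain,
  Amer. J. Math. 78 (1956), Thm. 3.
* [Cutkosky1997] S. D. Cutkosky, Local factorization of birational maps, Adv. Math. 132 (1997),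
  p. 167.
-/

noncomputable section

open IsLocalRing

universe u

namespace Literature.Barriers.ResolutionOfSingularities

open Literature.AlgebraicGeometry.Resolution

variable {K : Type u} [Field K]

/-! ### Sally's simple extensions and accessibility, verbatim (subrings of a field) -/

/-- The ring `R[u] ⊆ K` generated over the subring `R ⊆ K` by one element `u ∈ K`. [folklore] -/
def adjoinElem (R : Subring K) (u : K) : Subring K :=
  Subring.closure ((R : Set K) ∪ {u})

/-- `R ⊆ R[u]`. [folklore] -/
theorem le_adjoinElem (R : Subring K) (u : K) : R ≤ adjoinElem R u :=
  fun _ h => Subring.subset_closure (Or.inl h)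

/-- `u ∈ R[u]`. [folklore] -/
theorem mem_adjoinElem_self (R : Subring K) (u : K) : u ∈ adjoinElem R u :=
  Subring.subset_closure (Or.inr rfl)

/-- **Simple extension** in Sally's sense (Def. 4.1, verbatim): `T` is the localization at a
prime of rank `n = dim R` of the ring `R[p/q]` generated over the local ring `R` by a quotient
of two elements `p, q` of `R` "which form a subset of a minimal basis for `M`" (linearly
independent modulo `𝔪_R²`, `Sally1972.IndepModSq`). Inside `K`: `T` is local, contains `R[p/q]`,
consists of fractions `a/b` with `a, b ∈ R[p/q]` and `b` a unit of `T` (so `T = R[p/q]_𝔭` with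
`𝔭 = 𝔪_T ∩ R[p/q]`), and `dim T = dim R` (the rank of `𝔭`). Compare the weaker container notion
`Sally1972.IsSimpleExtension` (any over-ring containing `R` and `p/q`). [cite: Sally1972, Def. 4.1] -/
def IsStrictSimpleExtension (R T : Subring K) : Prop :=
  ∃ (_ : IsLocalRing R) (p q : R), Sally1972.IndepModSq R p q ∧ IsLocalRing T ∧
    adjoinElem R ((p : K) / (q : K)) ≤ T ∧
    (∀ z ∈ T, ∃ a ∈ adjoinElem R ((p : K) / (q : K)), ∃ b ∈ adjoinElem R ((p : K) / (q : K)),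
      b⁻¹ ∈ T ∧ z = a / b) ∧
    ringKrullDim T = ringKrullDim R

/-- **Accessible** in Sally's sense (Def. 4.1): `T` "can be obtained from `R` by a finite
sequence of simple extensions" (zero or more). [cite: Sally1972, Def. 4.1] -/
def IsStrictlyAccessible : Subring K → Subring K → Prop :=
  Relation.ReflTransGen IsStrictSimpleExtension

/-- A simple extension contains the ring. [cite: Sally1972, Def. 4.1] -/
theorem IsStrictSimpleExtension.le {R T : Subring K} (h : IsStrictSimpleExtension R T) : R ≤ T := by
  obtain ⟨_, p, q, -, -, hle, -⟩ := h
  exact (le_adjoinElem R _).trans hle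

/-- A simple extension contains the adjoined quotient. [cite: Sally1972, Def. 4.1] -/
theorem IsStrictSimpleExtension.exists_div_mem {R T : Subring K} (h : IsStrictSimpleExtension R T) :
    ∃ (_ : IsLocalRing R) (p q : R), Sally1972.IndepModSq R p q ∧ (p : K) / (q : K) ∈ T := by
  obtain ⟨hR, p, q, hpq, -, hle, -⟩ := h
  exact ⟨hR, p, q, hpq, hle (mem_adjoinElem_self R _)⟩

/-- An accessible over-ring contains the ring. [cite: Sally1972, Def. 4.1] -/
theorem IsStrictlyAccessible.le {R T : Subring K} (h : IsStrictlyAccessible R T) : R ≤ T := by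
  induction h with
  | refl => exact le_rfl
  | tail _ h ih => exact ih.trans h.le

/-- **Census predicate (row O2b), dimension `n`**: "every `n`-dimensional regular local
over-ring `T` of an `n`-dimensional regular local ring `R` of `K` (`QF(R) = K`) which dominates
`R` is accessible from `R`" — the statement Sally attributes to Zariski–Abhyankar for `n = 2`
and refutes for every `n > 2` (Thm. 4.4, Cor. 4.5). Binders as in the tree's
`AbhyankarQuadraticFactorization`. [cite: Sally1972, Def. 4.1 and Thm. 4.4] -/
def AccessibleInDim (n : ℕ) : Prop :=
  ∀ (K : Type u) [Field K] (R T : Subring K),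
    IsRegularLocalRing R → ringKrullDim R = n → IsLocalRingOf R →
    IsRegularLocalRing T → ringKrullDim T = n → SubringDominates R T →
    IsStrictlyAccessible R T

/-! ### Dimension two: quadratic transforms are strict simple extensions -/

/-- In a Noetherian local ring whose maximal ideal is not principal, two generators `p, q` of
`𝔪 = (p, q)` are linearly independent modulo `𝔪²` (Nakayama). [folklore] -/
theorem indepModSq_of_span_pair {S : Type*} [CommRing S] [IsLocalRing S] [IsNoetherianRing S]
    (hne : ∀ z : S, maximalIdeal S ≠ Ideal.span {z}) {p q : S}
    (hspan : maximalIdeal S = Ideal.span {p, q}) : Sally1972.IndepModSq S p q := by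
  have hp : p ∈ maximalIdeal S := hspan ▸ Ideal.subset_span (by simp)
  have hq : q ∈ maximalIdeal S := hspan ▸ Ideal.subset_span (by simp)
  -- Nakayama: if `a ∈ (b) + 𝔪²` and `𝔪 = (a, b)` then `𝔪 = (b)`
  have nak : ∀ a b : S, maximalIdeal S = Ideal.span {a, b} →
      a ∈ Ideal.span {b} ⊔ maximalIdeal S • maximalIdeal S → maximalIdeal S = Ideal.span {b} := by
    intro a b h ha
    have hb : b ∈ maximalIdeal S := h ▸ Ideal.subset_span (by simp)
    apply le_antisymm
    · refine Submodule.le_of_le_smul_of_le_jacobson_bot (I := maximalIdeal S)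
        (IsNoetherian.noetherian _) ?_ ?_
      · rw [IsLocalRing.jacobson_eq_maximalIdeal ⊥ bot_ne_top]
      · calc maximalIdeal S = Ideal.span {a, b} := h
          _ ≤ Ideal.span {b} ⊔ maximalIdeal S • maximalIdeal S := by
            refine Ideal.span_le.mpr ?_
            rintro x (rfl | rfl)
            · exact ha
            · exact Submodule.mem_sup_left (Ideal.subset_span rfl)
    · exact Ideal.span_le.mpr (by rintro x rfl; exact hb)
  have hsq : maximalIdeal S ^ 2 = maximalIdeal S • maximalIdeal S := by rw [sq, smul_eq_mul]
  refine ⟨hp, hq, fun r s hrs => ⟨?_, ?_⟩⟩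
  · by_contra hr
    have hru : IsUnit r := by
      by_contra h; exact hr ((IsLocalRing.mem_maximalIdeal _).mpr h)
    obtain ⟨ri, hri⟩ := hru.exists_left_inv
    apply hne q
    refine nak p q hspan ?_
    have : p = ri * (r * p + s * q) - ri * s * q := by
      calc p = (ri * r) * p := by rw [hri, one_mul]
        _ = ri * (r * p + s * q) - ri * s * q := by ring
    rw [this]
    refine Submodule.sub_mem _ (Submodule.mem_sup_right ?_) (Submodule.mem_sup_left ?_)
    · rw [← hsq]; exact Ideal.mul_mem_left _ _ hrs
    · exact Ideal.mul_mem_left _ _ (Ideal.subset_span rfl)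
  · by_contra hs
    have hsu : IsUnit s := by
      by_contra h; exact hs ((IsLocalRing.mem_maximalIdeal _).mpr h)
    obtain ⟨si, hsi⟩ := hsu.exists_left_inv
    apply hne p
    refine nak q p (by rw [hspan, Ideal.span_pair_comm]) ?_
    have : q = si * (r * p + s * q) - si * r * p := by
      calc q = (si * s) * q := by rw [hsi, one_mul]
        _ = si * (r * p + s * q) - si * r * p := by ring
    rw [this]
    refine Submodule.sub_mem _ (Submodule.mem_sup_right ?_) (Submodule.mem_sup_left ?_)
    · rw [← hsq]; exact Ideal.mul_mem_left _ _ hrs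
    · exact Ideal.mul_mem_left _ _ (Ideal.subset_span rfl)

/-- Exchange: if `𝔪 = (x, y)` and `x' = a x + b y` with `a` a unit, then `𝔪 = (x', y)`. [folklore] -/
theorem maximalIdeal_eq_span_pair_of_isUnit {S : Type*} [CommRing S] [IsLocalRing S]
    {x y x' a b : S} (hm : maximalIdeal S = Ideal.span {x, y}) (hab : a * x + b * y = x')
    (ha : IsUnit a) : maximalIdeal S = Ideal.span {x', y} := by
  have hx : x ∈ maximalIdeal S := hm ▸ Ideal.subset_span (by simp)
  have hy : y ∈ maximalIdeal S := hm ▸ Ideal.subset_span (by simp)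
  obtain ⟨ai, hai⟩ := ha.exists_left_inv
  apply le_antisymm
  · rw [hm]
    refine Ideal.span_le.mpr ?_
    rintro z (rfl | rfl)
    · have : z = ai * x' - ai * b * y := by
        calc z = (ai * a) * z := by rw [hai, one_mul]
          _ = ai * x' - ai * b * y := by rw [← hab]; ring
      rw [this]
      exact Submodule.sub_mem _ (Ideal.mul_mem_left _ _ (Ideal.subset_span (by simp)))
        (Ideal.mul_mem_left _ _ (Ideal.subset_span (by simp)))
    · exact Ideal.subset_span (by simp)
  · refine Ideal.span_le.mpr ?_
    rintro z (rfl | rfl)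
    · rw [← hab]
      exact Submodule.add_mem _ (Ideal.mul_mem_left _ _ hx) (Ideal.mul_mem_left _ _ hy)
    · exact hy

/-- `R[𝔪/x'] = R[y/x']` when `𝔪 = (x', y)`. [folklore] -/
theorem blowupRing_eq_adjoinElem {R : Subring K} [IsLocalRing R] {x' y : R}
    (hm : maximalIdeal R = Ideal.span {x', y}) (hx'0 : ((x' : R) : K) ≠ 0) :
    blowupRing R (x' : K) = adjoinElem R (((y : R) : K) / ((x' : R) : K)) := by
  rw [blowupRing_eq_closure_of_span_eq ((x' : R) : K) ({x', y} : Set R) hm.symm, Set.image_pair,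
    div_self hx'0]
  apply le_antisymm
  · refine Subring.closure_le.mpr ?_
    rintro z (hz | rfl | rfl)
    · exact le_adjoinElem R _ hz
    · exact Subring.one_mem _
    · exact mem_adjoinElem_self R _
  · exact Subring.closure_mono (Set.union_subset_union_right _ (by simp))

/-- **A quadratic transform of a two-dimensional regular local ring is a simple extension in
Sally's sense**: if `R → R₁` is a quadratic transform (`R₁ = R[𝔪/x']_𝔭`, `𝔭 ∩ R = 𝔪`) with
`dim R₁ = 2`, then `x' ∉ 𝔪²` (else `1 = Σ aᵢ (uᵢ/x') ∈ 𝔪 R₁`), so `𝔪 = (x', y)` for some `y`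
and `R₁ = R[y/x']_𝔭`. [cite: Sally1972, Def. 4.1] -/
theorem isStrictSimpleExtension_of_isQuadraticTransform {R R₁ : Subring K}
    (hR : IsRegularLocalRing R) (hRdim : ringKrullDim R = 2) (h : IsQuadraticTransform R R₁)
    (hdim₁ : ringKrullDim R₁ = 2) : IsStrictSimpleExtension R R₁ := by
  haveI := hR
  obtain ⟨_, x', hx'm, hx'0, hloc₁, hB, hfrac, hdom⟩ := h
  haveI := hloc₁
  have hx'K : ((x' : R) : K) ≠ 0 := fun h0 => hx'0 (Subtype.ext h0)
  obtain ⟨x, y, hm, -, -, -, -⟩ := exists_maximalIdeal_eq_span_pair (R := R) hRdim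
  have hx : x ∈ maximalIdeal R := hm ▸ Ideal.subset_span (by simp)
  have hy : y ∈ maximalIdeal R := hm ▸ Ideal.subset_span (by simp)
  obtain ⟨a, b, hab⟩ := Ideal.mem_span_pair.mp (hm ▸ hx'm : x' ∈ Ideal.span {x, y})
  -- `a` or `b` is a unit: otherwise `1 = a (x/x') + b (y/x') ∈ 𝔪_{R₁}`
  have hunit : IsUnit a ∨ IsUnit b := by
    by_contra hcon
    simp only [not_or] at hcon
    have ha : a ∈ maximalIdeal R := (IsLocalRing.mem_maximalIdeal _).mpr hcon.1
    have hb : b ∈ maximalIdeal R := (IsLocalRing.mem_maximalIdeal _).mpr hcon.2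
    have hX : ((x : R) : K) / ((x' : R) : K) ∈ R₁ := hB (div_mem_blowupRing _ hx)
    have hY : ((y : R) : K) / ((x' : R) : K) ∈ R₁ := hB (div_mem_blowupRing _ hy)
    have ha₁ : Subring.inclusion hdom.1 a ∈ maximalIdeal R₁ := (incl_mem_maximalIdeal_iff hdom a).mpr ha
    have hb₁ : Subring.inclusion hdom.1 b ∈ maximalIdeal R₁ := (incl_mem_maximalIdeal_iff hdom b).mpr hb
    have h1 : (1 : R₁) = Subring.inclusion hdom.1 a * ⟨_, hX⟩ + Subring.inclusion hdom.1 b * ⟨_, hY⟩ := by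
      apply Subtype.ext
      change (1 : K) = ((a : R) : K) * (((x : R) : K) / ((x' : R) : K)) +
        ((b : R) : K) * (((y : R) : K) / ((x' : R) : K))
      have e : ((x' : R) : K) = ((a : R) : K) * ((x : R) : K) + ((b : R) : K) * ((y : R) : K) := by
        rw [← hab]; push_cast; ring
      field_simp
      rw [e]
    have hmem : (1 : R₁) ∈ maximalIdeal R₁ := by
      rw [h1]
      exact Submodule.add_mem _ (Ideal.mul_mem_right _ _ ha₁) (Ideal.mul_mem_right _ _ hb₁)
    exact (maximalIdeal.isMaximal R₁).ne_top ((Ideal.eq_top_iff_one _).mpr hmem)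
  -- a regular system of parameters `(x', y₁)`
  obtain ⟨y₁, hm₁⟩ : ∃ y₁ : R, maximalIdeal R = Ideal.span {x', y₁} := by
    rcases hunit with ha | hb
    · exact ⟨y, maximalIdeal_eq_span_pair_of_isUnit hm hab ha⟩
    · exact ⟨x, maximalIdeal_eq_span_pair_of_isUnit (by rw [hm, Ideal.span_pair_comm])
        (show b * y + a * x = x' by rw [← hab]; ring) hb⟩
  have hindep : Sally1972.IndepModSq R y₁ x' :=
    indepModSq_of_span_pair (maximalIdeal_ne_span_singleton hRdim)
      (by rw [hm₁, Ideal.span_pair_comm])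
  have hEq := blowupRing_eq_adjoinElem hm₁ hx'K
  refine ⟨inferInstance, y₁, x', hindep, hloc₁, hEq ▸ hB, fun z hz => ?_, by rw [hdim₁, hRdim]⟩
  obtain ⟨c, hc, d, hd, hdinv, rfl⟩ := hfrac z hz
  exact ⟨c, hEq ▸ hc, d, hEq ▸ hd, hdinv, rfl⟩

/-- **Zariski–Abhyankar in Sally's language** (`n = 2`): every two-dimensional regular local
over-ring `T` of a two-dimensional regular local ring `R` of `K` dominating `R` is accessible from
`R` — "the factorization theorem of Zariski and Abhyankar [1] states that if `R` is a
2-dimensional regular local ring then every 2-dimensional regular local overring of `R` is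
accessible from `R`" (Sally, p. 295). Proof: the tree's proof of
`AbhyankarQuadraticFactorization_holds` (Huneke–Swanson 14.5.2), recording at each step that the
quadratic transform `Rₙ → Rₙ₊₁ ⊆ T` is a strict simple extension.
[cite: Sally1972, Def. 4.1] [cite: Abhyankar1956Valuations, Thm. 3] -/
theorem accessibleInDim_two : AccessibleInDim.{u} 2 := by
  intro K _ R S hR hRdim hRK hS hSdim hdom
  by_contra hcon
  haveI := hS
  let P : Subring K → Prop := fun R' => IsRegularLocalRing R' ∧ ringKrullDim R' = 2 ∧
    IsLocalRingOf R' ∧ SubringDominates R' S ∧ IsStrictlyAccessible R R'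
  have hP0 : P R := ⟨hR, hRdim, hRK, hdom, Relation.ReflTransGen.refl⟩
  have hstep : ∀ R', P R' → ∃ R'', P R'' ∧ IsQuadraticTransform R' R'' := by
    rintro R' ⟨h1, h2, h3, h4, h5⟩
    have hne : R' ≠ S := by
      rintro rfl; exact hcon h5
    obtain ⟨R'', hq, h1', h2', h3', h4'⟩ :=
      exists_quadraticTransform_dominated h1 h2 h3 hS hSdim h4 hne
    exact ⟨R'', ⟨h1', h2', h3', h4',
      h5.tail (isStrictSimpleExtension_of_isQuadraticTransform h1 h2 hq h2')⟩, hq⟩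
  choose next hnext using hstep
  let seq : ℕ → {R' : Subring K // P R'} :=
    fun n => Nat.rec ⟨R, hP0⟩ (fun _ ih => ⟨next ih.1 ih.2, (hnext ih.1 ih.2).1⟩) n
  let Rs : ℕ → Subring K := fun n => (seq n).1
  have hqt : ∀ n, IsQuadraticTransform (Rs n) (Rs (n + 1)) := fun n => (hnext _ (seq n).2).2
  have hdomn : ∀ n, SubringDominates (Rs n) S := fun n => (seq n).2.2.2.2.1
  have hof : IsLocalRingOf (Rs 0) := hRK
  -- `S` would be a valuation ring of `K`
  have hval : ∀ z : K, z ∈ S ∨ z⁻¹ ∈ S := by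
    intro z
    rcases exists_mem_or_inv_mem_of_sequence Rs hof hdomn hqt z with ⟨n, hn⟩ | ⟨n, hn⟩
    · exact Or.inl ((hdomn n).1 hn)
    · exact Or.inr ((hdomn n).1 hn)
  have hle := ringKrullDim_le_one_of_forall_mem_or_inv_mem hval
  rw [hSdim] at hle
  exact absurd hle (by decide)

/-! ### Dimension three: Sally–Shannon -/

open _root_.MvPolynomial in
/-- **`¬ AccessibleInDim 3`** (Sally 1972, Thm. 4.4 / Ex. 4.6; Shannon 1973): over `k = ℚ`, with
`K = k(t, y, z)` and `x = t(y² + z³)`, the three-dimensional regular local ring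
`T = k[t,y,z]_{(t,y,z)}` of `K` dominates `R = k[x,y,z]_{(x,y,z)}` (`QF(R) = K`) but is not
accessible from `R`: the first simple extension `R[p/q]_𝔭 ⊆ T` of a chain would put `p/q ∈ T`,
contradicting `Sally1972.div_not_mem_T`. [cite: Sally1972, Thm. 4.4 and Ex. 4.6]
[cite: Shannon1973] -/
theorem not_accessibleInDim_three : ¬ AccessibleInDim.{u} 3 := by
  intro h
  let k : Type u := ULift.{u} ℚ
  let K : Type u := FractionRing (MvPolynomial (Fin 3) k)
  let v : Fin 3 → K := fun i => algebraMap (MvPolynomial (Fin 3) k) K (X i)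
  have haeval : ∀ p : MvPolynomial (Fin 3) k, aeval v p = algebraMap (MvPolynomial (Fin 3) k) K p := by
    intro p
    have hfun : (aeval v : MvPolynomial (Fin 3) k →ₐ[k] K) =
        IsScalarTower.toAlgHom k (MvPolynomial (Fin 3) k) K :=
      MvPolynomial.algHom_ext fun i => by simp [v]
    exact congrArg (fun φ : MvPolynomial (Fin 3) k →ₐ[k] K => φ p) hfun
  have hv : AlgebraicIndependent k v := by
    intro p q hpq
    have hpq' : aeval v p = aeval v q := hpq
    rw [haeval, haeval] at hpq'
    exact IsFractionRing.injective (MvPolynomial (Fin 3) k) K hpq'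
  -- `QF(R) = K`
  have hRK : IsLocalRingOf (Sally1972.R hv).toSubring := by
    refine ⟨Sally1972.instIsLocalRingSubtypeMemSubalgebraR hv, fun w => ?_⟩
    obtain ⟨a, b, hb, rfl⟩ := IsFractionRing.div_surjective (A := MvPolynomial (Fin 3) k) w
    have hb0 : algebraMap (MvPolynomial (Fin 3) k) K b ≠ 0 :=
      IsFractionRing.to_map_ne_zero_of_mem_nonZeroDivisors hb
    have haT : algebraMap (MvPolynomial (Fin 3) k) K a ∈ Sally1972.T hv := by
      rw [← haeval]; exact aeval_mem_originLocalRing hv a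
    have hbT : algebraMap (MvPolynomial (Fin 3) k) K b ∈ Sally1972.T hv := by
      rw [← haeval]; exact aeval_mem_originLocalRing hv b
    obtain ⟨p₁, hp₁, p₂, hp₂, hp₂0, hpe⟩ := Sally1972.exists_div_eq_of_mem_T hv haT
    obtain ⟨q₁, hq₁, q₂, hq₂, hq₂0, hqe⟩ := Sally1972.exists_div_eq_of_mem_T hv hbT
    have hq₁0 : q₁ ≠ 0 := by
      rintro rfl
      exact hb0 (by rw [hqe, zero_div])
    refine ⟨p₁ * q₂, Subalgebra.mul_mem _ hp₁ hq₂, p₂ * q₁, Subalgebra.mul_mem _ hp₂ hq₁,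
      mul_ne_zero hp₂0 hq₁0, ?_⟩
    rw [hpe, hqe, div_div_div_eq]
  have hacc := h K (Sally1972.R hv).toSubring (Sally1972.T hv).toSubring
    (Sally1972.isRegularLocalRing_R hv) (Sally1972.ringKrullDim_R hv) hRK
    (Sally1972.isRegularLocalRing_T hv) (Sally1972.ringKrullDim_T hv) (Sally1972.dominates hv)
  rcases hacc.cases_head with hEq | ⟨R₁, h₁, hrest⟩
  · exact Sally1972.R_ne_T hv (Subalgebra.toSubring_injective hEq)
  · obtain ⟨_, p, q, hpq, hmem⟩ := h₁.exists_div_mem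
    have hpqT : (p : K) / (q : K) ∈ Sally1972.T hv := (IsStrictlyAccessible.le hrest) hmem
    exact Sally1972.div_not_mem_T hv p.2 q.2 hpq hpqT

end Literature.Barriers.ResolutionOfSingularities

end
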